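import Mathlib
import Summits.Ventures.PercRepro2.Defs
import Summits.Ventures.PercRepro2.Independence
import Summits.Ventures.PercRepro2.Harris
import Summits.Ventures.PercRepro2.Graph
import Summits.Ventures.PercRepro2.Events
import Summits.Ventures.PercRepro2.ZCClusterBlind
import Summits.Ventures.PercRepro2.ZCRootDecomp
import Summits.Ventures.PercRepro2.ZCCondProb
import Summits.Ventures.PercRepro2.ZCThetaPA
import Summits.Ventures.PercRepro2.CondAvoidPA
import Summits.Ventures.PercRepro2.ZCDirectCube
import Summits.Ventures.PercRepro2.ZCDirectFibre
import Summits.Ventures.PercRepro2.ZCDirectInfluence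
import Summits.Ventures.PercRepro2.ZCDirectFun
import Summits.Ventures.PercRepro2.ZCDirectMain
import Summits.Ventures.PercRepro2.ZCDirectLift
import Summits.Ventures.PercRepro2.ZCDirectFunMain

/-!
# The `N`-first split of the cluster-blind (ZC) form: row 2′ZC ⟸ `(ZC-N)` (blind cell PercRepro2, mine-a g29)

Condition on the attachment set `τ` (the edges of `a₁`) FIRST.  For the cluster-blind event
`Ũ = clusterBlindEvent ends a₁ a₃ o 𝓔` its (ZC) expression splits as

  `Z(Ũ) = ∑_τ w₂(τ)·Z_τ + [S·Cov(liftU u, 1_{e ∩ L}) − b·Cov(liftU u, 1_e)]`,   `u(τ) = P(Ũ ∣ τ)`,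

where `Z_τ = S·Cov_{σ₁}(Ũ_τ, (e ∩ L)_τ) − b·Cov_{σ₁}(Ũ_τ, e_τ)` is the (ZC) form of the DETERMINISTIC root
set `τ` computed in `G − a₁` (the fibres over `τ`), with the global constants `S = P(eᶜ ∩ Lᶜ)`,
`b = P(eᶜ ∩ Lᶜ ∩ γ)`.  The bracket is nonnegative by `zc_direct_fun` (`u` is a monotone `[0,1]`-observable
of `τ`).  Hence `Z(Ũ) ≥ ∑_τ w₂(τ)·Z_τ` (`zc_blind_ge_sum_fibT`), and with `zc_of_cluster_blind`:
**if `∑_τ w₂(τ)·Z_τ(𝓔) ≥ 0` for every up-set `𝓔` (the conjecture `(ZC-N)` of MINE-A.md §83.6) then (ZC)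
holds for every cluster up-set** (`zc_of_zcN`).  Exact census of `(ZC-N)`: 0 negatives (§83.6).
-/

namespace Summit.Ventures.PercRepro2

namespace ZCDirect

variable {V : Type*} {E : Type*} [Fintype V] [DecidableEq V] [Fintype E] [DecidableEq E]
  {R : Type*} [Field R] [LinearOrder R] [IsStrictOrderedRing R]

variable (ends : E → Sym2 V) (a₁ : V)

section NFirst

variable (p : E → R)

/-- The fibre of an event over the configuration `τ` of the edges of `a₁`. -/
def fibT (A : Set (Config E)) (τ : {e // e ∉ awayEdges ends a₁} → Bool) :
    Set ({e // e ∈ awayEdges ends a₁} → Bool) :=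
  {σ₁ | glue (awayEdges ends a₁) σ₁ τ ∈ A}

omit [LinearOrder R] [IsStrictOrderedRing R] in
/-- A probability as the `τ`-average of the fibre probabilities over `τ`. -/
lemma prob_eq_sum_fibT (A : Set (Config E)) :
    prob p A = ∑ τ : {e // e ∉ awayEdges ends a₁} → Bool,
      weight (fun i : {e // e ∉ awayEdges ends a₁} => p i) τ *
        prob (fun i : {e // e ∈ awayEdges ends a₁} => p i) (fibT ends a₁ A τ) := by
  rw [prob_eq_expect_indicator, expect_eq_sum_glue p _ (awayEdges ends a₁), Finset.sum_comm]
  refine Finset.sum_congr rfl fun τ _ => ?_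
  unfold prob
  rw [Finset.mul_sum]
  refine Finset.sum_congr rfl fun σ₁ _ => ?_
  by_cases h : glue (awayEdges ends a₁) σ₁ τ ∈ A
  · have h' : σ₁ ∈ fibT ends a₁ A τ := h
    rw [Set.indicator_of_mem h, Set.indicator_of_mem h']
    simp only [Pi.one_apply, mul_one]
    ring
  · have h' : σ₁ ∉ fibT ends a₁ A τ := h
    rw [Set.indicator_of_notMem h, Set.indicator_of_notMem h']
    ring

omit [LinearOrder R] [IsStrictOrderedRing R] in
/-- The expectation of a lifted observable against an event, `τ` outside. -/
lemma expect_liftU_mul_indicator_T (u : ({e // e ∉ awayEdges ends a₁} → Bool) → R)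
    (A : Set (Config E)) :
    expect p (fun ω => liftU ends a₁ u ω * A.indicator 1 ω) =
      ∑ τ : {e // e ∉ awayEdges ends a₁} → Bool,
        weight (fun i : {e // e ∉ awayEdges ends a₁} => p i) τ *
          (u τ * prob (fun i : {e // e ∈ awayEdges ends a₁} => p i) (fibT ends a₁ A τ)) := by
  rw [expect_eq_sum_glue p _ (awayEdges ends a₁), Finset.sum_comm]
  refine Finset.sum_congr rfl fun τ _ => ?_
  unfold prob
  rw [Finset.mul_sum, Finset.mul_sum]
  refine Finset.sum_congr rfl fun σ₁ _ => ?_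
  rw [liftU_glue]
  by_cases h : glue (awayEdges ends a₁) σ₁ τ ∈ A
  · have h' : σ₁ ∈ fibT ends a₁ A τ := h
    simp only [Set.indicator_of_mem h, Set.indicator_of_mem h', Pi.one_apply]
    ring
  · have h' : σ₁ ∉ fibT ends a₁ A τ := h
    simp only [Set.indicator_of_notMem h, Set.indicator_of_notMem h']
    ring

omit [LinearOrder R] [IsStrictOrderedRing R] in
/-- The expectation of a lifted observable, `τ` outside. -/
lemma expect_liftU_T (u : ({e // e ∉ awayEdges ends a₁} → Bool) → R) :
    expect p (liftU ends a₁ u) =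
      ∑ τ : {e // e ∉ awayEdges ends a₁} → Bool,
        weight (fun i : {e // e ∉ awayEdges ends a₁} => p i) τ * u τ := by
  rw [expect_eq_sum_glue p _ (awayEdges ends a₁), Finset.sum_comm]
  refine Finset.sum_congr rfl fun τ _ => ?_
  simp_rw [liftU_glue]
  rw [← Finset.sum_mul, ← Finset.sum_mul, sum_weight, one_mul]

/-- The fibre probability of an up-set is a monotone `[0,1]`-observable of `τ`. -/
lemma monotone_prob_fibT (hp : IsProbVec p) {A : Set (Config E)} (hA : IsUpperSet A) :
    Monotone (fun τ => prob (fun i : {e // e ∈ awayEdges ends a₁} => p i) (fibT ends a₁ A τ)) := by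
  intro τ τ' h
  show prob (fun i : {e // e ∈ awayEdges ends a₁} => p i) (fibT ends a₁ A τ) ≤
    prob (fun i : {e // e ∈ awayEdges ends a₁} => p i) (fibT ends a₁ A τ')
  refine prob_mono (p := fun i : {e // e ∈ awayEdges ends a₁} => p i)
    ⟨fun i => hp.nonneg i, fun i => hp.le_one i⟩ fun σ₁ hσ => ?_
  exact hA (glue_mono_right ends a₁ σ₁ h) hσ

/-- **The `N`-first split**: the cluster-blind (ZC) expression dominates the `τ`-average of the
deterministic-root-set (ZC) forms `Z_τ` (computed in `G − a₁` with the global constants). -/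
theorem zc_blind_ge_sum_fibT (hp : IsProbVec p) {𝓔 : Set (Set V)} (h𝓔 : IsUpperSet 𝓔) {a₃ o : V}
    (h3 : a₃ ≠ a₁) (ho : o ≠ a₁) :
    let e := connEvent ends a₁ a₃
    let L := connEvent ends a₁ o
    let γ := connEvent ends a₃ o
    let U' := clusterBlindEvent ends a₁ a₃ o 𝓔
    let S := prob p (eᶜ ∩ Lᶜ)
    let b := prob p (eᶜ ∩ Lᶜ ∩ γ)
    let p₁ : {e // e ∈ awayEdges ends a₁} → R := fun i => p i
    let p₂ : {e // e ∉ awayEdges ends a₁} → R := fun i => p i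
    ∑ τ : {e // e ∉ awayEdges ends a₁} → Bool, weight p₂ τ *
        (S * (prob p₁ (fibT ends a₁ U' τ ∩ fibT ends a₁ (e ∩ L) τ) -
            prob p₁ (fibT ends a₁ U' τ) * prob p₁ (fibT ends a₁ (e ∩ L) τ)) -
          b * (prob p₁ (fibT ends a₁ U' τ ∩ fibT ends a₁ e τ) -
            prob p₁ (fibT ends a₁ U' τ) * prob p₁ (fibT ends a₁ e τ))) ≤
      S * (prob p (U' ∩ (e ∩ L)) - prob p U' * prob p (e ∩ L)) -
        b * (prob p (U' ∩ e) - prob p U' * prob p e) := by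
  intro e L γ U' S b p₁ p₂
  classical
  set u : ({e // e ∉ awayEdges ends a₁} → Bool) → R := fun τ => prob p₁ (fibT ends a₁ U' τ) with hu
  have hp₁ : IsProbVec p₁ := ⟨fun i => hp.nonneg i, fun i => hp.le_one i⟩
  have hp₂ : IsProbVec p₂ := ⟨fun i => hp.nonneg i, fun i => hp.le_one i⟩
  have hU' : IsUpperSet U' := isUpperSet_clusterBlindEvent ends a₁ a₃ o h𝓔
  have humono : Monotone u := monotone_prob_fibT ends a₁ p hp hU'
  have hu0 : ∀ τ, 0 ≤ u τ := fun τ => prob_nonneg hp₁ _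
  have hu1 : ∀ τ, u τ ≤ 1 := fun τ => prob_le_one hp₁ _
  -- the between term is the functional (ZC-direct) expression of `u`
  have hfun := zc_direct_fun ends a₁ p hp humono hu0 hu1 h3 ho
  simp only [] at hfun
  -- rewrite it as `S·Cov(liftU u, eL) − b·Cov(liftU u, e)`
  have hUe : expect p (fun ω => liftU ends a₁ u ω * (e ∩ Lᶜ).indicator 1 ω) =
      expect p (fun ω => liftU ends a₁ u ω * e.indicator 1 ω) -
        expect p (fun ω => liftU ends a₁ u ω * (e ∩ L).indicator 1 ω) := by
    have h1 : e = (e ∩ L) ∪ (e ∩ Lᶜ) := by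
      ext ω; simp only [Set.mem_union, Set.mem_inter_iff, Set.mem_compl_iff]; tauto
    have h2 : Disjoint (e ∩ L) (e ∩ Lᶜ) := by
      rw [Set.disjoint_left]; rintro ω ⟨_, hL⟩ ⟨_, hL'⟩; exact hL' hL
    have := expect_mul_indicator_union p (liftU ends a₁ u) h2
    rw [← h1] at this
    linarith
  have he : prob p (e ∩ Lᶜ) = prob p e - prob p (e ∩ L) := by
    have := prob_inter_add_prob_inter_compl p e L
    linarith
  have hSbd : S = b + prob p (eᶜ ∩ Lᶜ ∩ γᶜ) :=
    (prob_inter_add_prob_inter_compl p (eᶜ ∩ Lᶜ) γ).symm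
  have hbetween : 0 ≤ S * (expect p (fun ω => liftU ends a₁ u ω * (e ∩ L).indicator 1 ω) -
      expect p (liftU ends a₁ u) * prob p (e ∩ L)) -
      b * (expect p (fun ω => liftU ends a₁ u ω * e.indicator 1 ω) -
        expect p (liftU ends a₁ u) * prob p e) := by
    rw [hUe, he] at hfun
    have hrew : prob p (eᶜ ∩ Lᶜ ∩ γᶜ) *
        (expect p (fun ω => liftU ends a₁ u ω * (e ∩ L).indicator 1 ω) -
          expect p (liftU ends a₁ u) * prob p (e ∩ L)) -
        prob p (eᶜ ∩ Lᶜ ∩ γ) *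
          (expect p (fun ω => liftU ends a₁ u ω * e.indicator 1 ω) -
              expect p (fun ω => liftU ends a₁ u ω * (e ∩ L).indicator 1 ω) -
            expect p (liftU ends a₁ u) * (prob p e - prob p (e ∩ L))) =
        S * (expect p (fun ω => liftU ends a₁ u ω * (e ∩ L).indicator 1 ω) -
          expect p (liftU ends a₁ u) * prob p (e ∩ L)) -
        b * (expect p (fun ω => liftU ends a₁ u ω * e.indicator 1 ω) -
          expect p (liftU ends a₁ u) * prob p e) := by
      rw [hSbd]; ring
    rw [← hrew]
    exact hfun
  -- the tower identities, `τ` outside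
  have hPU : prob p U' = expect p (liftU ends a₁ u) := by
    rw [prob_eq_sum_fibT ends a₁ p, expect_liftU_T ends a₁ p]
  have hUeL : prob p (U' ∩ (e ∩ L)) = ∑ τ : {e // e ∉ awayEdges ends a₁} → Bool, weight p₂ τ *
      prob p₁ (fibT ends a₁ U' τ ∩ fibT ends a₁ (e ∩ L) τ) := prob_eq_sum_fibT ends a₁ p _
  have hUe' : prob p (U' ∩ e) = ∑ τ : {e // e ∉ awayEdges ends a₁} → Bool, weight p₂ τ *
      prob p₁ (fibT ends a₁ U' τ ∩ fibT ends a₁ e τ) := prob_eq_sum_fibT ends a₁ p _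
  have hEeL := expect_liftU_mul_indicator_T ends a₁ p u (e ∩ L)
  have hEe := expect_liftU_mul_indicator_T ends a₁ p u e
  -- `Z(U') − ∑_τ w₂ Z_τ = the between term`
  have hdiff : S * (prob p (U' ∩ (e ∩ L)) - prob p U' * prob p (e ∩ L)) -
      b * (prob p (U' ∩ e) - prob p U' * prob p e) -
      ∑ τ : {e // e ∉ awayEdges ends a₁} → Bool, weight p₂ τ *
        (S * (prob p₁ (fibT ends a₁ U' τ ∩ fibT ends a₁ (e ∩ L) τ) -
            prob p₁ (fibT ends a₁ U' τ) * prob p₁ (fibT ends a₁ (e ∩ L) τ)) -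
          b * (prob p₁ (fibT ends a₁ U' τ ∩ fibT ends a₁ e τ) -
            prob p₁ (fibT ends a₁ U' τ) * prob p₁ (fibT ends a₁ e τ))) =
      S * (expect p (fun ω => liftU ends a₁ u ω * (e ∩ L).indicator 1 ω) -
          expect p (liftU ends a₁ u) * prob p (e ∩ L)) -
        b * (expect p (fun ω => liftU ends a₁ u ω * e.indicator 1 ω) -
          expect p (liftU ends a₁ u) * prob p e) := by
    have hZ : ∑ τ : {e // e ∉ awayEdges ends a₁} → Bool, weight p₂ τ *
        (S * (prob p₁ (fibT ends a₁ U' τ ∩ fibT ends a₁ (e ∩ L) τ) -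
            u τ * prob p₁ (fibT ends a₁ (e ∩ L) τ)) -
          b * (prob p₁ (fibT ends a₁ U' τ ∩ fibT ends a₁ e τ) -
            u τ * prob p₁ (fibT ends a₁ e τ))) =
        S * ∑ τ : {e // e ∉ awayEdges ends a₁} → Bool, weight p₂ τ *
            prob p₁ (fibT ends a₁ U' τ ∩ fibT ends a₁ (e ∩ L) τ) -
          S * ∑ τ : {e // e ∉ awayEdges ends a₁} → Bool, weight p₂ τ *
            (u τ * prob p₁ (fibT ends a₁ (e ∩ L) τ)) -
          b * ∑ τ : {e // e ∉ awayEdges ends a₁} → Bool, weight p₂ τ *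
            prob p₁ (fibT ends a₁ U' τ ∩ fibT ends a₁ e τ) +
          b * ∑ τ : {e // e ∉ awayEdges ends a₁} → Bool, weight p₂ τ *
            (u τ * prob p₁ (fibT ends a₁ e τ)) := by
      rw [Finset.mul_sum, Finset.mul_sum, Finset.mul_sum, Finset.mul_sum, ← Finset.sum_sub_distrib,
        ← Finset.sum_sub_distrib, ← Finset.sum_add_distrib]
      exact Finset.sum_congr rfl fun τ _ => by ring
    rw [hUeL, hUe', hEeL, hEe, hPU, expect_liftU_T ends a₁ p u, hZ]
    ring
  linarith [hdiff, hbetween]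

/-- **Row 2′ZC ⟸ `(ZC-N)`**: if for every up-set `𝓔` the attachment-average of the deterministic-root-set
(ZC) forms of the cluster-blind event is nonnegative, then (ZC) holds for every cluster up-set of the root
(through `zc_of_cluster_blind`). -/
theorem zc_of_zcN (hp : IsProbVec p) {a₃ o : V} (h3 : a₃ ≠ a₁) (ho : o ≠ a₁)
    (hN : ∀ 𝓔 : Set (Set V), IsUpperSet 𝓔 →
      let e := connEvent ends a₁ a₃
      let L := connEvent ends a₁ o
      let γ := connEvent ends a₃ o
      let U' := clusterBlindEvent ends a₁ a₃ o 𝓔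
      let S := prob p (eᶜ ∩ Lᶜ)
      let b := prob p (eᶜ ∩ Lᶜ ∩ γ)
      let p₁ : {e // e ∈ awayEdges ends a₁} → R := fun i => p i
      let p₂ : {e // e ∉ awayEdges ends a₁} → R := fun i => p i
      0 ≤ ∑ τ : {e // e ∉ awayEdges ends a₁} → Bool, weight p₂ τ *
        (S * (prob p₁ (fibT ends a₁ U' τ ∩ fibT ends a₁ (e ∩ L) τ) -
            prob p₁ (fibT ends a₁ U' τ) * prob p₁ (fibT ends a₁ (e ∩ L) τ)) -
          b * (prob p₁ (fibT ends a₁ U' τ ∩ fibT ends a₁ e τ) -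
            prob p₁ (fibT ends a₁ U' τ) * prob p₁ (fibT ends a₁ e τ))))
    {𝓔 : Set (Set V)} (h𝓔 : IsUpperSet 𝓔) :
    let e := connEvent ends a₁ a₃
    let L' := connEvent ends a₁ o
    let γ := connEvent ends a₃ o
    let U := clusterInEvent ends a₁ 𝓔
    0 ≤ prob p (eᶜ ∩ L'ᶜ ∩ γᶜ) * (prob p (U ∩ (e ∩ L')) - prob p U * prob p (e ∩ L'))
      - prob p (eᶜ ∩ L'ᶜ ∩ γ) * (prob p (U ∩ (e ∩ L'ᶜ)) - prob p U * prob p (e ∩ L'ᶜ)) := by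
  refine zc_of_cluster_blind hp a₁ a₃ o ?_ h𝓔
  intro 𝓔' h𝓔' e L' γ U'
  have hmain := zc_blind_ge_sum_fibT ends a₁ p hp h𝓔' h3 ho
  have hN' := hN 𝓔' h𝓔'
  simp only [] at hmain hN'
  -- the (D, B) form equals the (S, b) form
  have hUe : prob p (U' ∩ (e ∩ L'ᶜ)) = prob p (U' ∩ e) - prob p (U' ∩ (e ∩ L')) := by
    have := prob_inter_add_prob_inter_compl p (U' ∩ e) L'
    rw [Set.inter_assoc, Set.inter_assoc] at this
    linarith
  have he : prob p (e ∩ L'ᶜ) = prob p e - prob p (e ∩ L') := by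
    have := prob_inter_add_prob_inter_compl p e L'
    linarith
  have hSbd : prob p (eᶜ ∩ L'ᶜ) = prob p (eᶜ ∩ L'ᶜ ∩ γ) + prob p (eᶜ ∩ L'ᶜ ∩ γᶜ) :=
    (prob_inter_add_prob_inter_compl p (eᶜ ∩ L'ᶜ) γ).symm
  rw [hUe, he]
  have hrew : prob p (eᶜ ∩ L'ᶜ ∩ γᶜ) * (prob p (U' ∩ (e ∩ L')) - prob p U' * prob p (e ∩ L')) -
      prob p (eᶜ ∩ L'ᶜ ∩ γ) * (prob p (U' ∩ e) - prob p (U' ∩ (e ∩ L')) -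
        prob p U' * (prob p e - prob p (e ∩ L'))) =
      prob p (eᶜ ∩ L'ᶜ) * (prob p (U' ∩ (e ∩ L')) - prob p U' * prob p (e ∩ L')) -
        prob p (eᶜ ∩ L'ᶜ ∩ γ) * (prob p (U' ∩ e) - prob p U' * prob p e) := by
    rw [hSbd]; ring
  rw [hrew]
  exact le_trans hN' hmain

end NFirst

end ZCDirect

end Summit.Ventures.PercRepro2
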